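import Mathlib.LinearAlgebra.Alternating.Curry
import Mathlib.LinearAlgebra.Determinant
import Mathlib.LinearAlgebra.Orientation
import Mathlib.Analysis.InnerProductSpace.PiL2
import Mathlib.Topology.Algebra.Module.Multilinear.Topology
import Mathlib.Analysis.Normed.Module.FiniteDimension
import HarnessLib

/-!
# The generalized cross product of four vectors in a five-dimensional space

Route `SmoothPoincare4/SymplecticOrigami`, support item `FoldedSphereFoldExistence`
(stmt-SmoothPoincare4-14076): linear algebra for the passage "immersion `M⁴ ↬ ℝ⁵` of an oriented
manifold ⇒ `TM ⊕ ℝ` trivial" (sequel `…ImmersionR5StablyParallelizable.lean`). For a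
five-dimensional real vector space `W` with a fixed basis `b` and four vectors `a₀,…,a₃`:

* `crossFour b a = Σⱼ det_b(bⱼ, a₀, …, a₃) • bⱼ` (written out, no definition is introduced: the
  statements below carry the sum verbatim);
* `det_vecCons_sum_eq` — `det_b(cross, a) = Σⱼ det_b(bⱼ, a)²`;
* `exists_det_vecCons_ne_zero` — if `a` is linearly independent some `det_b(bⱼ, a) ≠ 0`;
* `det_vecCons_cross_pos` — hence `det_b(cross, a) > 0`, so `(cross, a)` is a basis
  (`linearIndependent_vecCons_cross`);
* `det_vecCons_comp_eq` — naturality in the frame: `det_b(bⱼ, g ∘ T ∘ e) = det T · det_b(bⱼ, g ∘ e)`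
  for a basis `e` of the parameter space, whence `cross (g ∘ T ∘ e) = det T • cross (g ∘ e)`
  (`cross_comp_eq_det_smul`);
* `continuous_det_vecCons` — continuity of `a ↦ det_b(w, a)`.
-/

noncomputable section

-- the prescribed namespace `Summit.<P>.<Sub>.…` duplicates `SmoothPoincare4` (P = Sub)
set_option linter.dupNamespace false

open Module Set Function

namespace Summit.SmoothPoincare4.SmoothPoincare4.Theorems.FoldedSphereFoldExistence

variable {W : Type*} [AddCommGroup W] [Module ℝ W]

/-- Linearity of `det_b(·, a)` in the first vector: `det_b(Σⱼ cⱼ bⱼ, a) = Σⱼ cⱼ det_b(bⱼ, a)`.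
[folklore] -/
theorem det_vecCons_sum (b : Basis (Fin 5) ℝ W) (a : Fin 4 → W) (c : Fin 5 → ℝ) :
    b.det (Matrix.vecCons (∑ j, c j • b j) a) = ∑ j, c j * b.det (Matrix.vecCons (b j) a) := by
  have hlin : IsLinearMap ℝ fun x : W => b.det (Matrix.vecCons x a) :=
    ⟨fun x y => b.det.map_vecCons_add a x y, fun r x => b.det.map_vecCons_smul a r x⟩
  set L : W →ₗ[ℝ] ℝ := IsLinearMap.mk' _ hlin with hL
  have hLa : ∀ x, L x = b.det (Matrix.vecCons x a) := fun x => rfl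
  rw [← hLa, map_sum]
  refine Finset.sum_congr rfl fun j _ => ?_
  rw [map_smul, smul_eq_mul, hLa]

/-- **`det_b(cross a, a) = Σⱼ det_b(bⱼ, a)²`** for the generalized cross product
`cross a = Σⱼ det_b(bⱼ, a) • bⱼ`. [folklore] -/
theorem det_vecCons_cross_eq (b : Basis (Fin 5) ℝ W) (a : Fin 4 → W) :
    b.det (Matrix.vecCons (∑ j, b.det (Matrix.vecCons (b j) a) • b j) a) =
      ∑ j, b.det (Matrix.vecCons (b j) a) ^ 2 := by
  rw [det_vecCons_sum]
  refine Finset.sum_congr rfl fun j _ => ?_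
  ring

/-- **A linearly independent quadruple has a non-zero minor**: if `a₀,…,a₃` are linearly
independent in the five-dimensional `W`, then `det_b(bⱼ, a) ≠ 0` for some basis vector `bⱼ`
(complete `a` by a vector outside its span to a basis; the functional `det_b(·, a)` is then
non-zero, hence non-zero on some `bⱼ`). [folklore] -/
theorem exists_det_vecCons_ne_zero (b : Basis (Fin 5) ℝ W) {a : Fin 4 → W}
    (ha : LinearIndependent ℝ a) : ∃ j, b.det (Matrix.vecCons (b j) a) ≠ 0 := by
  haveI : FiniteDimensional ℝ W := b.finiteDimensional_of_finite
  have hW : finrank ℝ W = 5 := by simpa using finrank_eq_card_basis b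
  -- a vector outside the span of `a`
  have hspan : Submodule.span ℝ (range a) ≠ ⊤ := by
    intro htop
    have h1 : finrank ℝ (Submodule.span ℝ (range a)) = 4 := by
      rw [finrank_span_eq_card ha]; simp
    rw [htop, finrank_top, hW] at h1
    norm_num at h1
  obtain ⟨x, -, hx⟩ : ∃ x ∈ (⊤ : Submodule ℝ W), x ∉ Submodule.span ℝ (range a) :=
    SetLike.exists_of_lt (lt_top_iff_ne_top.2 hspan)
  -- `(x, a)` is a basis, so its determinant is a unit
  have hli : LinearIndependent ℝ (Matrix.vecCons x a) := linearIndependent_finCons.2 ⟨ha, hx⟩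
  have hcard : Fintype.card (Fin 5) = finrank ℝ W := by rw [hW]; simp
  have hsp : ⊤ ≤ Submodule.span ℝ (range (Matrix.vecCons x a)) :=
    (hli.span_eq_top_of_card_eq_finrank hcard).ge
  have hunit : IsUnit (b.det (Matrix.vecCons x a)) :=
    (b.is_basis_iff_det).1 ⟨hli, top_le_iff.1 hsp⟩
  -- expand `x` on the basis `b`
  by_contra hall
  push Not at hall
  have hx' : x = ∑ j, b.repr x j • b j := (b.sum_repr x).symm
  have h0 : b.det (Matrix.vecCons x a) = 0 := by
    rw [hx', det_vecCons_sum]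
    exact Finset.sum_eq_zero fun j _ => by rw [hall j, mul_zero]
  exact hunit.ne_zero h0

/-- **Positivity**: for linearly independent `a`, `det_b(cross a, a) = Σⱼ det_b(bⱼ,a)² > 0`.
[folklore] -/
theorem det_vecCons_cross_pos (b : Basis (Fin 5) ℝ W) {a : Fin 4 → W}
    (ha : LinearIndependent ℝ a) :
    0 < b.det (Matrix.vecCons (∑ j, b.det (Matrix.vecCons (b j) a) • b j) a) := by
  rw [det_vecCons_cross_eq]
  obtain ⟨j, hj⟩ := exists_det_vecCons_ne_zero b ha
  exact Finset.sum_pos' (fun i _ => sq_nonneg _) ⟨j, Finset.mem_univ j, by positivity⟩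

/-- **`(cross a, a)` is linearly independent** (a basis of `W`) when `a` is. [folklore] -/
theorem linearIndependent_vecCons_cross (b : Basis (Fin 5) ℝ W) {a : Fin 4 → W}
    (ha : LinearIndependent ℝ a) :
    LinearIndependent ℝ (Matrix.vecCons (∑ j, b.det (Matrix.vecCons (b j) a) • b j) a) :=
  ((b.is_basis_iff_det).2 (isUnit_iff_ne_zero.2 (det_vecCons_cross_pos b ha).ne')).1

/-- **Naturality of the minors in the frame.** For a linear map `g : P → W`, an endomorphism
`T` of `P` and a basis `e` of `P` indexed by `Fin 4`:
`det_b(w, g(T e₀), …, g(T e₃)) = det T · det_b(w, g e₀, …, g e₃)` (an alternating `4`-form on `P`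
is a multiple of `det_e`). [folklore] -/
theorem det_vecCons_comp_eq {P : Type*} [AddCommGroup P] [Module ℝ P]
    (b : Basis (Fin 5) ℝ W) (e : Basis (Fin 4) ℝ P) (g : P →ₗ[ℝ] W) (T : P →ₗ[ℝ] P) (w : W) :
    b.det (Matrix.vecCons w (fun i => g (T (e i)))) =
      LinearMap.det T * b.det (Matrix.vecCons w (fun i => g (e i))) := by
  set φ : P [⋀^Fin 4]→ₗ[ℝ] ℝ := (b.det.curryLeft w).compLinearMap g with hφ
  have hφa : ∀ v : Fin 4 → P, φ v = b.det (Matrix.vecCons w (fun i => g (v i))) := fun v => by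
    simp only [hφ, AlternatingMap.compLinearMap_apply, AlternatingMap.curryLeft_apply_apply]
  have h1 : φ = φ e • e.det := φ.eq_smul_basis_det e
  have h2 : φ (fun i => T (e i)) = φ e * e.det (fun i => T (e i)) := by
    conv_lhs => rw [h1]
    rfl
  rw [← hφa, ← hφa, h2, show (fun i => T (e i)) = (T : P → P) ∘ e from rfl, e.det_comp,
    e.det_self, mul_one, mul_comm]

/-- **Naturality of the cross product**: `cross (g ∘ T ∘ e) = det T • cross (g ∘ e)`.
[folklore] -/
theorem cross_comp_eq_det_smul {P : Type*} [AddCommGroup P] [Module ℝ P]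
    (b : Basis (Fin 5) ℝ W) (e : Basis (Fin 4) ℝ P) (g : P →ₗ[ℝ] W) (T : P →ₗ[ℝ] P) :
    (∑ j, b.det (Matrix.vecCons (b j) (fun i => g (T (e i)))) • b j) =
      LinearMap.det T • ∑ j, b.det (Matrix.vecCons (b j) (fun i => g (e i))) • b j := by
  rw [Finset.smul_sum]
  refine Finset.sum_congr rfl fun j _ => ?_
  rw [det_vecCons_comp_eq, mul_smul]

/-- **Continuity of the minors** `a ↦ det_b(w, a)` on a finite-dimensional normed `W`
(a multilinear map on finite-dimensional spaces is continuous). [folklore] -/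
theorem continuous_det_vecCons {V : Type*} [NormedAddCommGroup V] [NormedSpace ℝ V]
    [FiniteDimensional ℝ V] (b : Basis (Fin 5) ℝ V) (w : V) :
    Continuous fun a : Fin 4 → V => b.det (Matrix.vecCons w a) := by
  classical
  have h1 : Continuous fun v : Fin 5 → V => b.det v := by
    simp_rw [Basis.det_apply]
    refine Continuous.matrix_det ?_
    refine continuous_pi fun i => continuous_pi fun j => ?_
    simp only [Basis.toMatrix_apply]
    exact (b.coord i).continuous_of_finiteDimensional.comp (continuous_apply j)
  have h2 : Continuous fun a : Fin 4 → V => (Matrix.vecCons w a : Fin 5 → V) := by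
    refine continuous_pi fun i => ?_
    refine Fin.cases ?_ (fun k => ?_) i
    · simpa using continuous_const
    · simpa using continuous_apply k
  exact h1.comp h2

end Summit.SmoothPoincare4.SmoothPoincare4.Theorems.FoldedSphereFoldExistence

end
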